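import Literature.NumberTheory.LFunctions.WeilBlockRowsFast
import HarnessLib

/-!
# Weil certificates: the rows of the check `D C = I` by LINEAR list traversals

Topic `Literature/NumberTheory/LFunctions` (kernel certificates of the Weil form, `WeilCert` format).  The row check
`WeilCert.checkDCRow p i` (`WeilBlockRows.lean`) computes row `i` of `D C` through INDEXED access
`getM A k l = (A.getD k []).getD l 0` inside a double loop — `O(nb² · (i + nb))` list steps per row, growing with the
row index; at `nb = 128` the late rows exceed the farm's per-`decide` budget (rows `≥ 40` of the landed certificate-H files
`WeilTwoPrimeOddMarginHDC10/11` fail a re-check today, row 42 intermittently).  This file computes the SAME rational row by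
one padded `axpy` fold over the rows of `C` (`axpyFold` of `WeilBlockRowsFast.lean`), `O(nb²)` steps per row:

* `WeilCert.dcRowF p i = Σ_k D_{ik} • C_k` — the fast row `i` of `D C`; `WeilCert.getV_dcRowF` — its entries;
* `WeilCert.checkDCRowF p i` — the fast row check (the shape condition `(C).length = nb` is part of the check);
* `WeilCert.checkDCRow_of_F` — the drop-in replacement: `checkDCRowF p i = true → checkDCRow p i = true`.

Pure bookkeeping; everything here is proved. [folklore]
-/

noncomputable section

open Finset
open scoped BigOperators

namespace Literature.NumberTheory.LFunctions

/-- `allBelow` only depends on the values of the predicate below `n`. [folklore] -/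
private theorem allBelow_congr {n : ℕ} {P Q : ℕ → Bool} (h : ∀ k < n, P k = Q k) : allBelow n P = allBelow n Q := by
  induction n with
  | zero => rfl
  | succ n ih =>
    rw [allBelow_succ, allBelow_succ, ih fun k hk ↦ h k (by omega), h n (by omega)]

namespace WeilCert

variable (c : WeilCert)

/-- Fast row `i` of `D C`: `Σ_k D_{ik} • C_k`, a padded `axpy` fold over the rows of `C`. [folklore] -/
def dcRowF (p i : ℕ) : List ℚ := axpyFold ((c.Db p).getD i []) (c.Cb p)

/-- Fast check of row `i` of `D C = I`, with the shape condition `(C).length = nb`. [folklore] -/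
def checkDCRowF (p i : ℕ) : Bool :=
  decide ((c.Cb p).length = c.nb) &&
    allBelow c.nb fun j ↦ decide (getV (c.dcRowF p i) j = if i = j then 1 else 0)

variable {c}

/-- Entries of the fast row: `(dcRowF p i)_j = Σ_{k < nb} D_{ik} C_{kj}` once `C` has `nb` rows — the row of the change-of-basis
check `D C = I` of the moment certificate (bookkeeping identity for the kernel check, ours).
[cite: Yoshida1992, §6, Thm 1 p. 310 (certificate format; the check `D C = I` row-wise)] -/
theorem getV_dcRowF {p : ℕ} (hC : (c.Cb p).length = c.nb) (i j : ℕ) :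
    getV (c.dcRowF p i) j = sumR c.nb fun k ↦ getM (c.Db p) i k * getM (c.Cb p) k j := by
  unfold dcRowF getV
  rw [getD_axpyFold, hC, sumR_eq_sum]
  rfl

/-- **`checkDCRow` from the fast check** (same proposition, cheaper kernel evaluation; drop-in for the certificate files).
[cite: Yoshida1992, §6, Thm 1 p. 310 (certificate format; the check `D C = I` row-wise)] -/
theorem checkDCRow_of_F {p i : ℕ} (h : c.checkDCRowF p i = true) : c.checkDCRow p i = true := by
  unfold checkDCRowF at h
  rw [Bool.and_eq_true, decide_eq_true_eq] at h
  obtain ⟨hC, hall⟩ := h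
  unfold checkDCRow
  rw [← hall]
  refine allBelow_congr fun j _ ↦ ?_
  rw [getV_dcRowF hC i j]

end WeilCert

end Literature.NumberTheory.LFunctions
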